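import Mathlib.Data.Real.Basic
import Mathlib.Algebra.Order.Field.Basic
import Mathlib.Tactic.Linarith
import Mathlib.Tactic.Positivity
import Mathlib.Tactic.Ring
import Mathlib.Tactic.FieldSimp
import Summits.CriticalPhenomena.PercolationContinuityZ3.Theorems.PercNearOneGluingNoHeavyLowerTailAPLVwAMGMStep
import HarnessLib

/-!
# `NoHeavyLowerTail` (stmt-CriticalPhenomena-4575) — the WINDOW LEMMA for the AM–GM step and the free-load (scheme B) variant

Support file (prover prim-ineq-gen-8 gen 48; `--supports stmt-CriticalPhenomena-4575`; memo
run/shared/lean/prim/prim-ineq-gen-8/FINDING-gen48-AMGM.md §0(12), §4(f),(g)).  Pure real algebra: no definitions, no named facts, no sorries.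

SETTING (companion `…APLVwAMGMStep.lean`).  At a boundary edge `e` (weight `p`, piece moments `a = E D`, `b = E D²`) of a state `S` the exact recursions are
`E¹L = E⁰L + a`, `V¹ = V⁰ + (b − a²) − 2κ` (`κ = |Cov_{S⁰}(L⁰, D)| ≥ 0`, the BHK cross-row sign), `EL = pE¹L + qE⁰L = E⁰L + pa`,
`V = pq a² + pV¹ + qV⁰`, and the size-biased form of the hypothesis-only step (L-V*) is `E¹E⁰·2a²V ≤ E¹E⁰(2ab·EL + pq a⁴) + (V¹E⁰ − V⁰E¹)²`
(`mhat_form`).  Writing `b = a·m̂`, `V⁰ = Θ₀·E⁰` and `δ₀ = Θ₀ − m̂` (how far the variance/mean ratio of the `e`-DELETED instance exceeds the size-biased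
piece load of `e`), everything is a polynomial identity [this work]:

  `(V¹E⁰ − V⁰E¹)² + E¹E⁰(2ab·EL − 2a²V + pq a⁴) = (E⁰)²u² + E¹E⁰(2pa²u − 2a²δ₀·EL − pq a⁴)`,  `u := a² + aδ₀ + 2κ`  (`window_identity`).

Consequences (memo Lemma B): the step holds at `e` whenever `δ₀ ≤ 0` (`window_of_ratio_le` — the forest case is `δ₀ < 0`), and whenever `δ₀ ≥ 0` lies OUTSIDE
the window `(δ₀ − E⁰L)² < (E⁰L)² − a²` (`window_of_outside`); in particular whenever `a ≥ E⁰L` (`window_of_mean_le_piece`).  So (L-V*) can fail at `e` only for a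
piece whose mean is below the mean load of the `e`-deleted instance AND whose size-biased load sits in a window of width `< 2E⁰L` just below `Θ₀` — which is
exactly how the counterexample to the largest-`m̂` rule of memo §4(f) was built, and why some other edge works there.  `mhat_form_free` is the free-load
(scheme B) variant of `mhat_form`: with `EL_f = pE¹_f + qE⁰_f + pℓ_y ≥ pE¹_f + qE⁰_f` the same size-biased condition suffices.
-/

noncomputable section

namespace Summit.CriticalPhenomena.PercolationContinuityZ3.Theorems

namespace APL

/-- **Window identity.**  With `E¹ = E⁰ + a`, `b = a m̂`, `V⁰ = Θ₀E⁰`, `V¹ = V⁰ + b − a² − 2κ`, `EL = E⁰ + pa`, `V = pq a² + pV¹ + qV⁰`,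
`δ₀ = Θ₀ − m̂`, `u = a² + aδ₀ + 2κ`:  `(V¹E⁰ − V⁰E¹)² + E¹E⁰(2ab·EL − 2a²V + pqa⁴) = (E⁰)²u² + E¹E⁰(2pa²u − 2a²δ₀EL − pqa⁴)`. [this work] -/
theorem window_identity (p a mh E0 Θ0 κ : ℝ) :
    let E1 := E0 + a
    let b := a * mh
    let V0 := Θ0 * E0
    let V1 := V0 + b - a ^ 2 - 2 * κ
    let EL := E0 + p * a
    let V := p * (1 - p) * a ^ 2 + p * V1 + (1 - p) * V0
    let δ0 := Θ0 - mh
    let u := a ^ 2 + a * δ0 + 2 * κ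
    (V1 * E0 - V0 * E1) ^ 2 + E1 * E0 * (2 * a * b * EL - 2 * a ^ 2 * V + p * (1 - p) * a ^ 4)
      = E0 ^ 2 * u ^ 2 + E1 * E0 * (2 * p * a ^ 2 * u - 2 * a ^ 2 * δ0 * EL - p * (1 - p) * a ^ 4) := by
  intro E1 b V0 V1 EL V δ0 u
  simp only [E1, b, V0, V1, EL, V, δ0, u]
  ring

/-- **Below the window: rest ratio at most the size-biased piece load.**  If `Θ₀ ≤ m̂` (`δ₀ ≤ 0`), `p ∈ [0,1]`, `a, E⁰, κ ≥ 0`, then the size-biased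
step condition holds: `E¹E⁰·2a²V ≤ E¹E⁰(2ab·EL + pqa⁴) + (V¹E⁰ − V⁰E¹)²` (indeed with slack `≥ E¹E⁰·pa⁴(1+p)`). [this work] -/
theorem window_of_ratio_le (p a mh E0 Θ0 κ E1 b V0 V1 EL V : ℝ) (hp0 : 0 ≤ p) (hp1 : p ≤ 1) (ha : 0 ≤ a) (hE0 : 0 ≤ E0)
    (hκ : 0 ≤ κ) (hδ : Θ0 ≤ mh)
    (hE1 : E1 = E0 + a) (hb : b = a * mh) (hV0 : V0 = Θ0 * E0) (hV1 : V1 = V0 + b - a ^ 2 - 2 * κ) (hEL : EL = E0 + p * a)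
    (hV : V = p * (1 - p) * a ^ 2 + p * V1 + (1 - p) * V0) :
    E1 * E0 * (2 * a ^ 2 * V) ≤ E1 * E0 * (2 * a * b * EL + p * (1 - p) * a ^ 4) + (V1 * E0 - V0 * E1) ^ 2 := by
  have hq : 0 ≤ 1 - p := by linarith
  have hid := window_identity p a mh E0 Θ0 κ
  simp only at hid
  subst hE1 hb hV0 hV1 hEL hV
  have hE1' : 0 ≤ E0 + a := by positivity
  -- the right-hand side of the identity is ≥ 0 when δ₀ ≤ 0:
  --   2 p a² u − 2 a² δ₀ EL − p q a⁴ ≥ 2pa²(a² + aδ₀) + 2 a² (−δ₀) p a − p q a⁴ = p a⁴ (1 + p) ≥ 0  (using EL ≥ pa, κ ≥ 0)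
  have hneg : 0 ≤ -(Θ0 - mh) := by linarith
  have h1 : 0 ≤ 2 * p * a ^ 2 * (a ^ 2 + a * (Θ0 - mh) + 2 * κ) - 2 * a ^ 2 * (Θ0 - mh) * (E0 + p * a)
      - p * (1 - p) * a ^ 4 := by
    have e1 : 2 * a ^ 2 * (-(Θ0 - mh)) * (E0 + p * a) ≥ 2 * a ^ 2 * (-(Θ0 - mh)) * (p * a) := by
      apply mul_le_mul_of_nonneg_left (by linarith) (by positivity)
    nlinarith [e1, mul_nonneg (mul_nonneg hp0 (pow_nonneg ha 2)) hκ, mul_nonneg hp0 (pow_nonneg ha 4),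
               mul_nonneg (mul_nonneg hp0 hp0) (pow_nonneg ha 4)]
  have h2 : 0 ≤ E0 ^ 2 * (a ^ 2 + a * (Θ0 - mh) + 2 * κ) ^ 2 := by positivity
  have h3 : 0 ≤ (E0 + a) * E0 * (2 * p * a ^ 2 * (a ^ 2 + a * (Θ0 - mh) + 2 * κ)
      - 2 * a ^ 2 * (Θ0 - mh) * (E0 + p * a) - p * (1 - p) * a ^ 4) := mul_nonneg (by positivity) h1
  nlinarith [hid, h2, h3]

/-- **Outside the window.**  If `δ₀ = Θ₀ − m̂ ≥ 0` but `(δ₀ − E⁰)² + a² ≥ (E⁰)²` (e.g. `a ≥ E⁰`, or `δ₀ ≥ 2E⁰`), then again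
`E¹E⁰·2a²V ≤ E¹E⁰(2ab·EL + pqa⁴) + (V¹E⁰ − V⁰E¹)²`.  A failure of the step at `e` therefore needs `a < E⁰L` and `δ₀` within `E⁰L ± √((E⁰L)² − a²)`. [this work] -/
theorem window_of_outside (p a mh E0 Θ0 κ E1 b V0 V1 EL V : ℝ) (hp0 : 0 ≤ p) (hp1 : p ≤ 1) (ha : 0 ≤ a) (hE0 : 0 ≤ E0)
    (hκ : 0 ≤ κ) (hδ : mh ≤ Θ0) (hout : E0 ^ 2 ≤ (Θ0 - mh - E0) ^ 2 + a ^ 2)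
    (hE1 : E1 = E0 + a) (hb : b = a * mh) (hV0 : V0 = Θ0 * E0) (hV1 : V1 = V0 + b - a ^ 2 - 2 * κ) (hEL : EL = E0 + p * a)
    (hV : V = p * (1 - p) * a ^ 2 + p * V1 + (1 - p) * V0) :
    E1 * E0 * (2 * a ^ 2 * V) ≤ E1 * E0 * (2 * a * b * EL + p * (1 - p) * a ^ 4) + (V1 * E0 - V0 * E1) ^ 2 := by
  have hq : 0 ≤ 1 - p := by linarith
  have hid := window_identity p a mh E0 Θ0 κ
  simp only at hid
  subst hE1 hb hV0 hV1 hEL hV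
  set δ := Θ0 - mh with hδdef
  have hδ0 : 0 ≤ δ := by rw [hδdef]; linarith
  set u := a ^ 2 + a * δ + 2 * κ with hudef
  have hu_lb : a * (a + δ) ≤ u := by rw [hudef]; nlinarith
  have hu0 : 0 ≤ u := le_trans (by positivity) hu_lb
  -- lower bound:  E0² u² + E1 E0 (2pa²u − 2a²δ EL − pq a⁴) ≥ E0 a² { E0[(a+δ)² − 2δE1] + E1 p a² (1+p) } ≥ 0
  have hsq : E0 ^ 2 * (a * (a + δ)) ^ 2 ≤ E0 ^ 2 * u ^ 2 := by
    have := mul_self_le_mul_self (by positivity) hu_lb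
    nlinarith [this, sq_nonneg E0]
  have hlin : (E0 + a) * E0 * (2 * p * a ^ 2 * (a * (a + δ))) ≤ (E0 + a) * E0 * (2 * p * a ^ 2 * u) := by
    apply mul_le_mul_of_nonneg_left _ (by positivity)
    exact mul_le_mul_of_nonneg_left hu_lb (by positivity)
  have hkey : (a + δ) ^ 2 - 2 * δ * (E0 + a) = (δ - E0) ^ 2 + a ^ 2 - E0 ^ 2 := by ring
  have hwin : 0 ≤ (a + δ) ^ 2 - 2 * δ * (E0 + a) := by rw [hkey]; nlinarith [hout]
  have hcore : 0 ≤ E0 * a ^ 2 * (E0 * ((a + δ) ^ 2 - 2 * δ * (E0 + a)) + (E0 + a) * (p * a ^ 2 * (1 + p))) := by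
    have : 0 ≤ E0 * ((a + δ) ^ 2 - 2 * δ * (E0 + a)) + (E0 + a) * (p * a ^ 2 * (1 + p)) := by positivity
    positivity
  have hexp : E0 ^ 2 * (a * (a + δ)) ^ 2 + (E0 + a) * E0 * (2 * p * a ^ 2 * (a * (a + δ))
      - 2 * a ^ 2 * δ * (E0 + p * a) - p * (1 - p) * a ^ 4)
      = E0 * a ^ 2 * (E0 * ((a + δ) ^ 2 - 2 * δ * (E0 + a)) + (E0 + a) * (p * a ^ 2 * (1 + p))) := by ring
  nlinarith [hid, hsq, hlin, hcore, hexp]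

/-- **Corollary: a piece at least as heavy (in mean) as the rest never fails.**  If `a ≥ E⁰` (and the sign conventions above) the size-biased step
condition holds at `e`, whatever `Θ₀`. [this work] -/
theorem window_of_mean_le_piece (p a mh E0 Θ0 κ E1 b V0 V1 EL V : ℝ) (hp0 : 0 ≤ p) (hp1 : p ≤ 1) (ha : 0 ≤ a) (hE0 : 0 ≤ E0)
    (hκ : 0 ≤ κ) (haE : E0 ≤ a)
    (hE1 : E1 = E0 + a) (hb : b = a * mh) (hV0 : V0 = Θ0 * E0) (hV1 : V1 = V0 + b - a ^ 2 - 2 * κ) (hEL : EL = E0 + p * a)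
    (hV : V = p * (1 - p) * a ^ 2 + p * V1 + (1 - p) * V0) :
    E1 * E0 * (2 * a ^ 2 * V) ≤ E1 * E0 * (2 * a * b * EL + p * (1 - p) * a ^ 4) + (V1 * E0 - V0 * E1) ^ 2 := by
  rcases le_total Θ0 mh with h | h
  · exact window_of_ratio_le p a mh E0 Θ0 κ E1 b V0 V1 EL V hp0 hp1 ha hE0 hκ h hE1 hb hV0 hV1 hEL hV
  · refine window_of_outside p a mh E0 Θ0 κ E1 b V0 V1 EL V hp0 hp1 ha hE0 hκ h ?_ hE1 hb hV0 hV1 hEL hV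
    nlinarith [sq_nonneg (Θ0 - mh - E0), mul_self_le_mul_self hE0 haE]

/-- **Scheme B (free loads).**  If the mean used on the left is `EL' ≥ pE¹ + qE⁰` (e.g. `EL_f = pE¹_f + qE⁰_f + pℓ_y` with the hub's own load
`ℓ_y ≥ 0`), the size-biased condition with `EL := pE¹ + qE⁰` still gives the discriminant form with `EL'`. [this work] -/
theorem mhat_form_free (p a b E1 E0 V1 V0 V EL EL' : ℝ) (hp0 : 0 ≤ p) (hp1 : p ≤ 1) (hE1 : 0 < E1) (hE0 : 0 < E0)
    (hV : V = p * (1 - p) * a ^ 2 + p * V1 + (1 - p) * V0) (hEL : EL = p * E1 + (1 - p) * E0) (hEL' : EL ≤ EL')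
    (hab : 0 ≤ a * b)
    (hloc : E1 * E0 * (2 * a ^ 2 * V) ≤ E1 * E0 * (2 * a * b * EL + p * (1 - p) * a ^ 4) + (V1 * E0 - V0 * E1) ^ 2) :
    V ^ 2 ≤ EL' * (p * (V1 ^ 2 / E1) + (1 - p) * (V0 ^ 2 / E0) + 2 * (p * (1 - p)) * a * b) := by
  have h := mhat_form p a b E1 E0 V1 V0 V EL hp0 hp1 hE1 hE0 hV hEL hloc
  have hq : 0 ≤ 1 - p := by linarith
  have hbr : 0 ≤ p * (V1 ^ 2 / E1) + (1 - p) * (V0 ^ 2 / E0) + 2 * (p * (1 - p)) * a * b := by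
    have : 0 ≤ 2 * (p * (1 - p)) * a * b := by nlinarith [mul_nonneg (mul_nonneg hp0 hq) hab]
    positivity
  exact h.trans (mul_le_mul_of_nonneg_right hEL' hbr)

end APL

end Summit.CriticalPhenomena.PercolationContinuityZ3.Theorems
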